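import Mathlib
import Summits.NavierStokesRegularity.NavierStokesRegularity.Theorems.TaoLadderRungTwoBreakBlowupRigidityOneSubcriticalCeiling
import Summits.NavierStokesRegularity.NavierStokesRegularity.Theorems.TaoLadderRungTwoBreakBlowupRigidityOneSurvivalPeaks
import HarnessLib

/-!
# The endpoint `a = 1`: a SMALL (S₁)-CRITICAL amplitude ceiling on the high shells keeps a `ν̂`-viscous flow regular, hence
  every renormalised viscous companion of a ROBUST blow-up is `EternalSurvivingFwd 1` — the survival predicate of
  `stub_eternalFromBlowup` (K2(1) `TaoLadderRungTwoBreak.BlowupRigidityOne`, stmt-NavierStokesRegularity-20206) at the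
  REGISTERED exponent, for the viscous blow-ups (`ν̂ > 0`) before any ω-limit

MODEL lattice ODEs only (Tao 2016 §4: the NS-scaled viscous lattice before Theorem 4.2, (4.3), Lemma 4.1 (4.5), §6.4);
nothing here is a statement about the Navier–Stokes equations; NO item is closed (`--supports
stmt-NavierStokesRegularity-20206`). Route-independent, general `m`, DEF-FREE. Sharpens `…SubcriticalCeiling` (strictly
sub-(S₁) envelopes of ANY size) to (S₁)-CRITICAL envelopes of SMALL size — the lattice analogue of small-data regularity
in a scaling-critical space:
* `weight45_bounded_of_smallCriticalCeiling` — amplitudes `≤ D`, and on the shells `j ≥ J` `‖x_j(t)‖ ≤ B ν^j` with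
  `(1+ε₀)ν² ≤ 1` and `0 ≤ B ≤ ν̂/(2(C_A+1)(1+ε₀)^9)` (`C_A = shiftConst α (0,0,1)`) ⇒ bounded (4.5) norm on `[0,T)` (one
  damped shell `norm_shellVec_le_of_dampedShell`, recursion `a_k ≤ c₀θ^k a_{k-1}²`, squaring of the normalised amplitudes;
  at the critical rate smallness of `B` replaces the decay of the ratio back-reaction/dissipation and of the seed);
* `criticalFloor_of_noGlobalCascade` — ROBUST BLOW-UP ⇒ for every `0 < ν̂ ≤ κ/√2` the maximal `ν̂`-viscous flow has, on
  arbitrarily high shells, times with `(1+ε₀)^j ‖x_j(t)‖² > B₀²`, `B₀ = ν̂/(2(C_A+1)(1+ε₀)^9)`;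
* `eternalSurvivingFwd_one_viscous_of_noGlobalCascade` — hence its renormalisation `W_n(σ) = Λ^n e^{-σ} x_n(T - e^{-σ})` is
  `EternalSurvivingFwd 1 ε₀ W` (lateness automatic, `eternalSurvivingFwd_one_of_peaks`).
POSITION. The stub wants `∃ W, IsEternal ε₀ α W ∧ EternalSurvivingFwd 1 ε₀ W` (admissible INVISCID two-sided eternal);
K2ᵛ ⟨20420⟩ wants `IsEternalVisc` + `UniformBound` + the same survival. Proved here: the survival clause at `a = 1` for the
PRE-LIMIT renormalised viscous blow-ups (law of `IsEternalVisc ε₀ ν̂ α` on `e^{-σ} < T`, `viscousBlowupProfile_of_noGlobalCascade`),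
level `c = B₀(ν̂)² → 0` as `ν̂ → 0`. OPEN: type I / the front bundle (ω-limit keeping the floor), the inviscid flow, a
`ν̂`-uniform level. HONEST LABEL: no stub, crux or summit is proved; rung 0.
-/

noncomputable section

-- the summit and its single sub-problem share the name (CONVENTIONS §1)
set_option linter.dupNamespace false

open Set Filter Topology

namespace Summit.NavierStokesRegularity.NavierStokesRegularity.Theorems

namespace BlowupRigidityOne

open Literature.Analysis.FluidPDE Literature.Analysis.FluidPDE.TaoCascade

variable {m : ℕ}

set_option maxHeartbeats 400000 in
/-- **SMALL CRITICAL CEILING ON THE HIGH SHELLS ⇒ (4.5)-REGULAR.** `ε₀ > 0`, `ν̂ > 0`, `α` cancelling; `X` a `ν̂`-viscous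
flow on `[0,T)` (`C¹`, viscous motion within `[0,∞)`) from the one-shell datum `X₀` at shell `0`, no shells below `0`,
amplitudes bounded by `D`. If for the shells `j ≥ J` and all `t ∈ [0,T)` `‖x_j(t)‖ ≤ B ν^j` with `0 < ν`,
`(1+ε₀) ν² ≤ 1` and `0 ≤ B ≤ ν̂/(2(C_A+1)(1+ε₀)^9)`, then `sup_{i,n}(1+(1+ε₀)^{10n})|X_{i,n}(t)|` is bounded on `[0,T)`.
[cite: Tao2016AveragedNS, §4 Lemma 4.1 (4.5) and the viscous equation before Thm. 4.2; Cheskidov2008, §4 Thm. 4.3–4.4 (analogy: regularity at/above the critical dissipation strength)] -/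
theorem weight45_bounded_of_smallCriticalCeiling {ε₀ visc T B ν D : ℝ} {J : ℕ} (hε : 0 < ε₀) (hvisc : 0 < visc)
    {α : Fin m → Fin m → Fin m → ℤ × ℤ × ℤ → ℝ} (hc : IsCancellingCoeff α)
    {X : Fin m → ℤ → ℝ → ℝ} {X₀ : Fin m → ℝ}
    (hC1 : ∀ i n, ContDiffOn ℝ 1 (X i n) (Set.Ico 0 T))
    (hinit : ∀ i n, X i n 0 = if n = 0 then X₀ i else 0)
    (hlow : ∀ i n t, n < 0 → X i n t = 0)
    (hmot : ∀ i n t, 0 ≤ t → t < T → derivWithin (X i n) (Set.Ici 0) t =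
      quadTerm ε₀ α X i n t - visc * (1 + ε₀) ^ ((2 : ℝ) * n) * X i n t)
    (hD : ∀ (j : ℤ) (t : ℝ), 0 ≤ t → t < T → ‖shellVec X j t‖ ≤ D)
    (hν : 0 < ν) (hcrit : (1 + ε₀) * ν ^ 2 ≤ 1) (hB0 : 0 ≤ B)
    (hBsmall : B ≤ visc / (2 * (shiftConst α (0, 0, 1) + 1) * (1 + ε₀) ^ 9))
    (hamp : ∀ (j : ℤ) (t : ℝ), (J : ℤ) ≤ j → 0 ≤ t → t < T → ‖shellVec X j t‖ ≤ B * ν ^ j) :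
    ∃ M : ℝ, ∀ t : ℝ, 0 ≤ t → t < T → ∀ (i : Fin m) (n : ℤ),
      (1 + (1 + ε₀) ^ ((10 : ℝ) * n)) * |X i n t| ≤ M := by
  rcases le_or_gt T 0 with hT | hT
  · exact ⟨0, fun t ht htT => absurd (lt_of_le_of_lt ht htT) (not_lt.2 hT)⟩
  have hb : (0 : ℝ) < 1 + ε₀ := by linarith
  have hb1 : (1 : ℝ) ≤ 1 + ε₀ := by linarith
  have hΛ : 0 < bigLam ε₀ := bigLam_pos (by linarith)
  have hΛ1 : 1 ≤ bigLam ε₀ := by unfold bigLam; exact Real.one_le_rpow hb1 (by norm_num)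
  have hD0 : 0 ≤ D := (norm_nonneg _).trans (hD 0 0 le_rfl hT)
  have hν1 : ν ≤ 1 := by
    by_contra h; push Not at h
    nlinarith [one_lt_pow₀ h (two_ne_zero)]
  set P : ℝ := (1 + ε₀) ^ 2 with hP_def
  have hP : 0 < P := by positivity
  set θ : ℝ := bigLam ε₀ / P with hθ_def
  have hθ : 0 < θ := div_pos hΛ hP
  have hθsq : θ ^ 2 = 1 + ε₀ := by
    rw [hθ_def, div_pow, bigLam_sq hε.le, hP_def]
    field_simp
  have hΛθ : bigLam ε₀ = θ * P := by rw [hθ_def]; field_simp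
  set ρ : ℝ := θ * ν with hρ_def
  have hρ : 0 < ρ := mul_pos hθ hν
  have hρ1 : ρ ≤ 1 := by
    have h2 : ρ ^ 2 ≤ 1 := by rw [hρ_def, mul_pow, hθsq]; exact hcrit
    by_contra h; push Not at h
    linarith [one_lt_pow₀ h (two_ne_zero) (M₀ := ℝ)]
  set C : ℝ := shiftConst α (0, 0, 1) + 1 with hC_def
  have hC0 : 0 ≤ shiftConst α (0, 0, 1) := shiftConst_nonneg α _
  have hSC : shiftConst α (0, 0, 1) ≤ C := by rw [hC_def]; linarith
  have hC : 0 < C := lt_of_le_of_lt hC0 (by rw [hC_def]; linarith)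
  set c₀ : ℝ := 2 * C / (visc * bigLam ε₀) with hc₀_def
  have hc₀ : 0 < c₀ := by positivity
  set W : ℝ := (1 + ε₀) ^ 10 with hW_def
  have hW : 1 ≤ W := one_le_pow₀ (by linarith)
  have hW0 : 0 < W := by positivity
  set δ : ℝ := min 1 (θ / W) with hδ_def
  have hδ : 0 < δ := lt_min one_pos (by positivity)
  have hδ1 : δ ≤ 1 := min_le_left _ _
  have hδW : W * δ ≤ θ := by
    calc W * δ ≤ W * (θ / W) := mul_le_mul_of_nonneg_left (min_le_right _ _) hW0.le
      _ = θ := by field_simp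
  -- the two smallness consequences of `B ≤ ν̂/(2C(1+ε₀)^9)`: damping dominance and a small seed
  have h9 : (1 : ℝ) ≤ (1 + ε₀) ^ 9 := one_le_pow₀ hb1
  have hCB : 2 * C * B * (1 + ε₀) ^ 9 ≤ visc := by
    have h := (le_div_iff₀ (by positivity)).1 hBsmall
    calc 2 * C * B * (1 + ε₀) ^ 9 = B * (2 * C * (1 + ε₀) ^ 9) := by ring
      _ ≤ visc := h
  have hdampB : 2 * C * B ≤ visc :=
    calc 2 * C * B = 2 * C * B * 1 := (mul_one _).symm
      _ ≤ 2 * C * B * (1 + ε₀) ^ 9 := mul_le_mul_of_nonneg_left h9 (by positivity)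
      _ ≤ visc := hCB
  have hseed : c₀ * θ ^ 2 * B ≤ δ := by
    have hWθ : W * θ ≤ bigLam ε₀ * (1 + ε₀) ^ 9 := by
      have h : (1 + ε₀) ^ 10 ≤ (1 + ε₀) ^ 11 := pow_le_pow_right₀ hb1 (by norm_num)
      calc W * θ = θ * (1 + ε₀) ^ 10 := by rw [hW_def]; ring
        _ ≤ θ * (1 + ε₀) ^ 11 := mul_le_mul_of_nonneg_left h hθ.le
        _ = bigLam ε₀ * (1 + ε₀) ^ 9 := by rw [hΛθ, hP_def]; ring
    have hle1 : c₀ * θ ^ 2 * B ≤ θ / W := by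
      rw [hc₀_def, div_mul_eq_mul_div, div_mul_eq_mul_div, div_le_div_iff₀ (by positivity) hW0]
      have h1 : 2 * C * θ ^ 2 * B * W = θ * (2 * C * B) * (W * θ) := by ring
      rw [h1]
      have h2 : θ * (2 * C * B) * (W * θ) ≤ θ * (2 * C * B) * (bigLam ε₀ * (1 + ε₀) ^ 9) :=
        mul_le_mul_of_nonneg_left hWθ (by positivity)
      have h3 : θ * (2 * C * B) * (bigLam ε₀ * (1 + ε₀) ^ 9) = θ * bigLam ε₀ * (2 * C * B * (1 + ε₀) ^ 9) := by ring
      have h4 : θ * bigLam ε₀ * (2 * C * B * (1 + ε₀) ^ 9) ≤ θ * bigLam ε₀ * visc :=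
        mul_le_mul_of_nonneg_left hCB (by positivity)
      have h5 : θ * bigLam ε₀ * visc = θ * (visc * bigLam ε₀) := by ring
      linarith [h2, h3, h4, h5]
    have hle2 : c₀ * θ ^ 2 * B ≤ 1 := by
      rw [hc₀_def, hθsq, div_mul_eq_mul_div, div_mul_eq_mul_div, div_le_one (by positivity)]
      have h19 : (1 + ε₀) ≤ (1 + ε₀) ^ 9 := le_self_pow₀ hb1 (by norm_num)
      have h1 : 2 * C * (1 + ε₀) * B ≤ 2 * C * B * (1 + ε₀) ^ 9 :=
        calc 2 * C * (1 + ε₀) * B = 2 * C * B * (1 + ε₀) := by ring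
          _ ≤ 2 * C * B * (1 + ε₀) ^ 9 := mul_le_mul_of_nonneg_left h19 (by positivity)
      have h2 : visc ≤ visc * bigLam ε₀ := le_mul_of_one_le_right hvisc.le hΛ1
      linarith [hCB]
    exact le_min hle2 hle1
  have hPk : ∀ k : ℕ, (1 + ε₀) ^ ((2 : ℝ) * ((k : ℤ) : ℝ)) = P ^ k := fun k => by
    rw [Int.cast_natCast, Real.rpow_mul hb.le, Real.rpow_two, Real.rpow_natCast]
  have hWk : ∀ k : ℕ, (1 + ε₀) ^ ((10 : ℝ) * ((k : ℤ) : ℝ)) = W ^ k := fun k => by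
    rw [Int.cast_natCast, Real.rpow_mul hb.le, show (10 : ℝ) = ((10 : ℕ) : ℝ) by norm_num,
      Real.rpow_natCast, Real.rpow_natCast]
  have hder : ∀ i k, ∀ τ ∈ Ico (0 : ℝ) T, HasDerivWithinAt (X i k)
      (quadTerm ε₀ α X i k τ - visc * (1 + ε₀) ^ ((2 : ℝ) * k) * X i k τ) (Ici 0) τ := by
    intro i k τ hτ
    have hd : DifferentiableWithinAt ℝ (X i k) (Ico 0 T) τ := ((hC1 i k).differentiableOn one_ne_zero) τ hτ
    have hd' : DifferentiableWithinAt ℝ (X i k) (Ici 0) τ :=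
      hd.mono_of_mem_nhdsWithin (by
        rw [mem_nhdsWithin]
        exact ⟨Iio T, isOpen_Iio, hτ.2, fun x hx => ⟨hx.2, hx.1⟩⟩)
    rw [← hmot i k τ hτ.1 hτ.2]
    exact hd'.hasDerivWithinAt
  set k₁ : ℕ := max J 1 with hk₁_def
  have hk₁J : J ≤ k₁ := le_max_left _ _
  have hampI : ∀ (j : ℤ), (k₁ : ℤ) ≤ j → ∀ t ∈ Ico (0 : ℝ) T, ‖shellVec X j t‖ ≤ B * ν ^ j :=
    fun j hj t ht => hamp j t ((Int.ofNat_le.2 hk₁J).trans hj) ht.1 ht.2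
  set b : ℕ → ℝ := fun n => Nat.rec (motive := fun _ => ℝ) (B * ν ^ k₁)
    (fun n bn => c₀ * θ ^ (k₁ + n + 1) * bn ^ 2) n with hb_def
  have hb0 : b 0 = B * ν ^ k₁ := rfl
  have hbs : ∀ n, b (n + 1) = c₀ * θ ^ (k₁ + n + 1) * b n ^ 2 := fun n => rfl
  clear_value b
  have hb_nonneg : ∀ n, 0 ≤ b n := fun n => by
    induction n with
    | zero => rw [hb0]; positivity
    | succ n _ => rw [hbs]; positivity
  have hclaim : ∀ n : ℕ, ∀ t ∈ Ico (0 : ℝ) T, ‖shellVec X ((k₁ + n : ℕ) : ℤ) t‖ ≤ b n := fun n => by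
    induction n with
    | zero =>
      intro t ht
      rw [hb0, Nat.add_zero]
      simpa only [zpow_natCast] using hampI (k₁ : ℤ) le_rfl t ht
    | succ n ih =>
      intro t ht
      have hk0 : ¬ ((k₁ : ℤ) + ((n : ℤ) + 1) = 0) := by omega
      have hkm1 : ((k₁ + (n + 1) : ℕ) : ℤ) - 1 = ((k₁ + n : ℕ) : ℤ) := by push_cast; ring
      have hkp1 : ((k₁ + (n + 1) : ℕ) : ℤ) + 1 = ((k₁ + (n + 1) + 1 : ℕ) : ℤ) := by push_cast; ring
      have h0 : shellVec X ((k₁ + (n + 1) : ℕ) : ℤ) 0 = 0 := by ext i; simp [shellVec, hinit, hk0]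
      have hβ' : ∀ s ∈ Ico (0 : ℝ) T, ‖shellVec X (((k₁ + (n + 1) : ℕ) : ℤ) - 1) s‖ ≤ b n :=
        fun s hs => by rw [hkm1]; exact ih s hs
      have hγ' : ∀ s ∈ Ico (0 : ℝ) T,
          ‖shellVec X (((k₁ + (n + 1) : ℕ) : ℤ) + 1) s‖ ≤ B * ν ^ (((k₁ + (n + 1) : ℕ) : ℤ) + 1) :=
        fun s hs => hampI _ (by push_cast; linarith) s hs
      have hdamp' : 2 * bigLam ε₀ ^ ((k₁ + (n + 1) : ℕ) : ℤ) * shiftConst α (0, 0, 1) *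
          (B * ν ^ (((k₁ + (n + 1) : ℕ) : ℤ) + 1)) ≤ visc * (1 + ε₀) ^ ((2 : ℝ) * (((k₁ + (n + 1) : ℕ) : ℤ) : ℝ)) := by
        rw [hkp1, zpow_natCast, zpow_natCast, hPk, hΛθ, mul_pow, pow_succ]
        have hPK : 0 ≤ P ^ (k₁ + (n + 1)) := pow_nonneg hP.le _
        have hρK : ρ ^ (k₁ + (n + 1)) ≤ 1 := pow_le_one₀ hρ.le hρ1
        have e1 : 2 * (θ ^ (k₁ + (n + 1)) * P ^ (k₁ + (n + 1))) * shiftConst α (0, 0, 1) *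
            (B * (ν ^ (k₁ + (n + 1)) * ν)) =
            (2 * shiftConst α (0, 0, 1) * B * ν * ρ ^ (k₁ + (n + 1))) * P ^ (k₁ + (n + 1)) := by
          rw [hρ_def, mul_pow]; ring
        rw [e1]
        have e2 : 2 * shiftConst α (0, 0, 1) * B * ν * ρ ^ (k₁ + (n + 1)) ≤ 2 * C * B := by
          have hq1 : 2 * shiftConst α (0, 0, 1) * B * ν * ρ ^ (k₁ + (n + 1)) ≤
              2 * C * B * ν * ρ ^ (k₁ + (n + 1)) := by
            have hq : 0 ≤ 2 * B * ν * ρ ^ (k₁ + (n + 1)) := by positivity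
            nlinarith [mul_le_mul_of_nonneg_right hSC hq]
          have hq2 : 2 * C * B * ν * ρ ^ (k₁ + (n + 1)) ≤ 2 * C * B := by
            have hq : 0 ≤ 2 * C * B := by positivity
            calc 2 * C * B * ν * ρ ^ (k₁ + (n + 1)) = 2 * C * B * (ν * ρ ^ (k₁ + (n + 1))) := by ring
              _ ≤ 2 * C * B * 1 :=
                  mul_le_mul_of_nonneg_left (mul_le_one₀ hν1 (pow_nonneg hρ.le _) hρK) hq
              _ = 2 * C * B := mul_one _
          linarith
        calc (2 * shiftConst α (0, 0, 1) * B * ν * ρ ^ (k₁ + (n + 1))) * P ^ (k₁ + (n + 1))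
            ≤ (2 * C * B) * P ^ (k₁ + (n + 1)) := mul_le_mul_of_nonneg_right e2 hPK
          _ ≤ visc * P ^ (k₁ + (n + 1)) := mul_le_mul_of_nonneg_right hdampB hPK
      have hstep := norm_shellVec_le_of_dampedShell hε hvisc hc (fun i => hder i _) h0 hβ' hγ' hdamp' t ht
      calc ‖shellVec X ((k₁ + (n + 1) : ℕ) : ℤ) t‖
          ≤ 2 * (bigLam ε₀ ^ (((k₁ + (n + 1) : ℕ) : ℤ) - 1) * shiftConst α (0, 0, 1) * b n ^ 2) /
              (visc * (1 + ε₀) ^ ((2 : ℝ) * (((k₁ + (n + 1) : ℕ) : ℤ) : ℝ))) := hstep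
        _ ≤ 2 * (bigLam ε₀ ^ (((k₁ + (n + 1) : ℕ) : ℤ) - 1) * C * b n ^ 2) /
              (visc * (1 + ε₀) ^ ((2 : ℝ) * (((k₁ + (n + 1) : ℕ) : ℤ) : ℝ))) := by
            gcongr
        _ = b (n + 1) := by
            rw [hbs n, hkm1, zpow_natCast, hPk, hc₀_def, hΛθ, mul_pow]
            field_simp
            ring
  -- the normalised amplitudes square at each step and start below `δ`
  have hu : ∀ n : ℕ, c₀ * θ ^ (k₁ + n + 2) * b n ≤ δ ^ (n + 1) := fun n => by
    induction n with
    | zero =>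
      rw [hb0, Nat.add_zero, zero_add, pow_one]
      have hρK : ρ ^ k₁ ≤ 1 := pow_le_one₀ hρ.le hρ1
      calc c₀ * θ ^ (k₁ + 2) * (B * ν ^ k₁) = c₀ * θ ^ 2 * B * ρ ^ k₁ := by rw [hρ_def, mul_pow]; ring
        _ ≤ c₀ * θ ^ 2 * B * 1 := mul_le_mul_of_nonneg_left hρK (by positivity)
        _ ≤ δ := by rw [mul_one]; exact hseed
    | succ n ih =>
      have hun : 0 ≤ c₀ * θ ^ (k₁ + n + 2) * b n :=
        mul_nonneg (mul_nonneg hc₀.le (pow_nonneg hθ.le _)) (hb_nonneg n)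
      have heq : c₀ * θ ^ (k₁ + (n + 1) + 2) * b (n + 1) = (c₀ * θ ^ (k₁ + n + 2) * b n) ^ 2 := by
        rw [hbs]; ring
      rw [heq]
      calc (c₀ * θ ^ (k₁ + n + 2) * b n) ^ 2 ≤ (δ ^ (n + 1)) ^ 2 := pow_le_pow_left₀ hun ih 2
        _ = δ ^ (2 * n + 2) := by rw [← pow_mul]; ring_nf
        _ ≤ δ ^ (n + 1 + 1) := pow_le_pow_of_le_one hδ.le hδ1 (by omega)
  have hhigh : ∀ n : ℕ, W ^ (k₁ + n) * b n ≤ W ^ k₁ / (c₀ * θ ^ (k₁ + 2)) := by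
    intro n
    have hpos : 0 < c₀ * θ ^ (k₁ + n + 2) := by positivity
    have h1 : c₀ * θ ^ (k₁ + n + 2) * (W ^ (k₁ + n) * b n) ≤ W ^ (k₁ + n) * δ ^ (n + 1) := by
      calc c₀ * θ ^ (k₁ + n + 2) * (W ^ (k₁ + n) * b n)
          = W ^ (k₁ + n) * (c₀ * θ ^ (k₁ + n + 2) * b n) := by ring
        _ ≤ W ^ (k₁ + n) * δ ^ (n + 1) := mul_le_mul_of_nonneg_left (hu n) (by positivity)
    have h2 : W ^ (k₁ + n) * δ ^ (n + 1) ≤ W ^ k₁ * θ ^ n := by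
      rw [pow_add, pow_succ]
      calc W ^ k₁ * W ^ n * (δ ^ n * δ) = W ^ k₁ * ((W * δ) ^ n * δ) := by rw [mul_pow]; ring
        _ ≤ W ^ k₁ * (θ ^ n * 1) := by
            refine mul_le_mul_of_nonneg_left ?_ (by positivity)
            exact mul_le_mul (pow_le_pow_left₀ (by positivity) hδW n) hδ1 hδ.le (pow_nonneg hθ.le n)
        _ = W ^ k₁ * θ ^ n := by ring
    have h3 : W ^ (k₁ + n) * b n ≤ W ^ k₁ * θ ^ n / (c₀ * θ ^ (k₁ + n + 2)) := by
      rw [le_div_iff₀' hpos]; exact h1.trans h2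
    exact h3.trans (le_of_eq (by field_simp; ring))
  refine ⟨2 * (W ^ k₁ / (c₀ * θ ^ (k₁ + 2)) + W ^ k₁ * D), fun t ht htT i n => ?_⟩
  have hM1 : 0 ≤ W ^ k₁ / (c₀ * θ ^ (k₁ + 2)) := by positivity
  have hM2 : 0 ≤ W ^ k₁ * D := by positivity
  rcases lt_or_ge n 0 with hn | hn
  · rw [hlow i n t hn, abs_zero, mul_zero]; positivity
  · obtain ⟨k, rfl⟩ := Int.eq_ofNat_of_zero_le hn
    have hcomp : |X i (k : ℤ) t| ≤ ‖shellVec X (k : ℤ) t‖ := by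
      rw [← shellVec_apply X (k : ℤ) t i]; exact abs_apply_le_norm _ _
    have hWk1 : 1 + (1 + ε₀) ^ ((10 : ℝ) * ((k : ℤ) : ℝ)) ≤ 2 * W ^ k := by
      rw [hWk]; linarith [one_le_pow₀ (n := k) hW]
    rcases lt_or_ge k k₁ with hk | hk
    · have h2 : W ^ k ≤ W ^ k₁ := pow_le_pow_right₀ hW hk.le
      calc (1 + (1 + ε₀) ^ ((10 : ℝ) * ((k : ℤ) : ℝ))) * |X i (k : ℤ) t|
          ≤ 2 * W ^ k * D := mul_le_mul hWk1 (hcomp.trans (hD _ t ht htT)) (abs_nonneg _) (by positivity)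
        _ ≤ 2 * W ^ k₁ * D := by gcongr
        _ ≤ 2 * (W ^ k₁ / (c₀ * θ ^ (k₁ + 2)) + W ^ k₁ * D) := by linarith [hM1]
    · obtain ⟨n, rfl⟩ := Nat.exists_eq_add_of_le hk
      have h1 : ‖shellVec X ((k₁ + n : ℕ) : ℤ) t‖ ≤ b n := hclaim n t ⟨ht, htT⟩
      calc (1 + (1 + ε₀) ^ ((10 : ℝ) * (((k₁ + n : ℕ) : ℤ) : ℝ))) * |X i ((k₁ + n : ℕ) : ℤ) t|
          ≤ 2 * W ^ (k₁ + n) * b n := mul_le_mul hWk1 (hcomp.trans h1) (abs_nonneg _) (by positivity)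
        _ = 2 * (W ^ (k₁ + n) * b n) := by ring
        _ ≤ 2 * (W ^ k₁ / (c₀ * θ ^ (k₁ + 2))) := mul_le_mul_of_nonneg_left (hhigh n) (by norm_num)
        _ ≤ 2 * (W ^ k₁ / (c₀ * θ ^ (k₁ + 2)) + W ^ k₁ * D) := by linarith [hM2]

/-- **ROBUST BLOW-UP ⇒ AN (S₁)-FLOOR WITH VISCOSITY-PROPORTIONAL CONSTANT ON ARBITRARILY HIGH SHELLS OF EVERY VISCOUS
COMPANION.** If `NoGlobalCascade ε₀ α X₀` (`ε₀ > 0`, `α ∈ E₂(R)`, any `m`), there is `κ > 0` such that for every viscosity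
`0 < ν̂ ≤ κ/√2` the maximal `ν̂`-viscous flow from the one-shell datum (`C¹` on `[0,T)`, datum, no shells below `0`, viscous
motion, (4.5)-regular before `T`, (4.5) norm unbounded) has, for every `J`, a shell `j ≥ J` and a time `t ∈ [0,T)` with
`(1+ε₀)^j ‖x_j(t)‖² > B₀²`, `B₀ = ν̂/(2(C_A+1)(1+ε₀)^9)`, `C_A = shiftConst α (0,0,1)`.
[cite: Tao2016AveragedNS, §4 Thm. 4.2, the viscous equation before Thm. 4.2, Lemma 4.1 (4.5); Teschl2012, §2.6 Cor. 2.16] -/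
theorem criticalFloor_of_noGlobalCascade {ε₀ R : ℝ} (hε : 0 < ε₀)
    {α : Fin m → Fin m → Fin m → ℤ × ℤ × ℤ → ℝ} {X₀ : Fin m → ℝ} (hα : InTableClass R α)
    (hNG : NoGlobalCascade ε₀ α X₀) :
    ∃ κ : ℝ, 0 < κ ∧ ∀ visc : ℝ, 0 < visc → visc * Real.sqrt 2 ≤ κ →
      ∃ (T : ℝ) (X : Fin m → ℤ → ℝ → ℝ), 0 < T ∧
        (∀ i n, ContDiffOn ℝ 1 (X i n) (Set.Ico 0 T)) ∧
        (∀ i n, X i n 0 = if n = 0 then X₀ i else 0) ∧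
        (∀ i n t, n < 0 → X i n t = 0) ∧
        (∀ i n t, 0 ≤ t → t < T → derivWithin (X i n) (Set.Ici 0) t =
          quadTerm ε₀ α X i n t - visc * (1 + ε₀) ^ ((2 : ℝ) * n) * X i n t) ∧
        (∀ T' : ℝ, 0 < T' → T' < T → ∃ M : ℝ, ∀ t : ℝ, 0 ≤ t → t ≤ T' →
          ∀ (i : Fin m) (n : ℤ), (1 + (1 + ε₀) ^ ((10 : ℝ) * n)) * |X i n t| ≤ M) ∧
        (∀ M : ℝ, ∃ t : ℝ, 0 ≤ t ∧ t < T ∧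
          ∃ (i : Fin m) (n : ℤ), M < (1 + (1 + ε₀) ^ ((10 : ℝ) * n)) * |X i n t|) ∧
        ∀ J : ℕ, ∃ (j : ℕ) (t : ℝ), J ≤ j ∧ 0 ≤ t ∧ t < T ∧
          (visc / (2 * (shiftConst α (0, 0, 1) + 1) * (1 + ε₀) ^ 9)) ^ 2 <
            (1 + ε₀) ^ j * ‖shellVec X (j : ℤ) t‖ ^ 2 := by
  obtain ⟨κ, hκ, H⟩ := maximalViscousFlow_of_noGlobalCascade hε hα hNG
  refine ⟨κ, hκ, fun visc hvisc hvk => ?_⟩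
  obtain ⟨T, X, hT, h1, h2, h3, h4, h5, h6⟩ := H visc hvisc.le hvk
  refine ⟨T, X, hT, h1, h2, h3, h4, h5, h6, fun J => ?_⟩
  have hb : (0 : ℝ) < 1 + ε₀ := by linarith
  -- the energy bound `‖x_k(t)‖ ≤ √m ‖X₀‖` along the viscous flow
  have hder : ∀ i k, ∀ τ ∈ Ico (0 : ℝ) T, HasDerivWithinAt (X i k)
      (quadTerm ε₀ α X i k τ - visc * (1 + ε₀) ^ ((2 : ℝ) * k) * X i k τ) (Ici 0) τ := by
    intro i k τ hτ
    have hd : DifferentiableWithinAt ℝ (X i k) (Ico 0 T) τ :=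
      ((h1 i k).differentiableOn one_ne_zero) τ hτ
    have hd' : DifferentiableWithinAt ℝ (X i k) (Ici 0) τ :=
      hd.mono_of_mem_nhdsWithin (by
        rw [mem_nhdsWithin]
        exact ⟨Iio T, isOpen_Iio, hτ.2, fun x hx => ⟨hx.2, hx.1⟩⟩)
    rw [← h4 i k τ hτ.1 hτ.2]
    exact hd'.hasDerivWithinAt
  have hreg : ∀ T' : ℝ, T' < T → ∃ M : ℝ, ∀ τ ∈ Icc (0 : ℝ) T', ∀ (i : Fin m) (k : ℤ),
      (1 + (1 + ε₀) ^ ((10 : ℝ) * k)) * |X i k τ| ≤ M := by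
    intro T' hT'
    rcases le_or_gt T' 0 with h0 | h0
    · obtain ⟨M, hM⟩ := h5 (T / 2) (by linarith) (by linarith)
      exact ⟨M, fun τ hτ i k => hM τ hτ.1 (by linarith [hτ.2]) i k⟩
    · obtain ⟨M, hM⟩ := h5 T' h0 hT'
      exact ⟨M, fun τ hτ i k => hM τ hτ.1 hτ.2 i k⟩
  have hamp := viscous_abs_le_datumNorm hε hvisc.le hα.2.1 hder h2 h3 hreg
  have hD : ∀ (k : ℤ) (t : ℝ), 0 ≤ t → t < T → ‖shellVec X k t‖ ≤ Real.sqrt m * Real.sqrt (∑ j, X₀ j ^ 2) :=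
    fun k t ht htT => DSSOneShift.norm_shellVec_le_sqrt_mul (Real.sqrt_nonneg _) (fun i => hamp t ⟨ht, htT⟩ i k)
  set B₀ : ℝ := visc / (2 * (shiftConst α (0, 0, 1) + 1) * (1 + ε₀) ^ 9) with hB₀_def
  have hC0 : 0 ≤ shiftConst α (0, 0, 1) := shiftConst_nonneg α _
  have hB₀ : 0 < B₀ := by positivity
  set ν : ℝ := (Real.sqrt (1 + ε₀))⁻¹ with hν_def
  have hsq : 0 < Real.sqrt (1 + ε₀) := Real.sqrt_pos.2 hb
  have hν : 0 < ν := inv_pos.2 hsq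
  have hνsq : ν ^ 2 = (1 + ε₀)⁻¹ := by rw [hν_def, inv_pow, Real.sq_sqrt hb.le]
  have hcrit : (1 + ε₀) * ν ^ 2 ≤ 1 := by rw [hνsq, mul_inv_cancel₀ hb.ne']
  by_contra hcon
  push Not at hcon
  have hceil : ∀ (j : ℤ) (t : ℝ), (J : ℤ) ≤ j → 0 ≤ t → t < T → ‖shellVec X j t‖ ≤ B₀ * ν ^ j := by
    intro j t hj ht htT
    obtain ⟨n, rfl⟩ := Int.eq_ofNat_of_zero_le ((Int.natCast_nonneg J).trans hj)
    have hn : J ≤ n := by exact_mod_cast hj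
    have h := hcon n t hn ht htT
    have hpow : (B₀ * ν ^ (n : ℤ)) ^ 2 * (1 + ε₀) ^ n = B₀ ^ 2 := by
      rw [zpow_natCast, mul_pow, ← pow_mul, mul_comm n 2, pow_mul, hνsq, inv_pow, mul_assoc,
        inv_mul_cancel₀ (pow_ne_zero _ hb.ne'), mul_one]
    have hle : ‖shellVec X (n : ℤ) t‖ ^ 2 ≤ (B₀ * ν ^ (n : ℤ)) ^ 2 := by nlinarith [hpow, h, pow_pos hb n]
    exact (pow_le_pow_iff_left₀ (norm_nonneg _) (by positivity) two_ne_zero).1 hle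
  obtain ⟨M, hM⟩ :=
    weight45_bounded_of_smallCriticalCeiling hε hvisc hα.2.1 h1 h2 h3 h4 hD hν hcrit hB₀.le le_rfl hceil
  obtain ⟨t, ht0, htT, i, n, hlt⟩ := h6 M
  exact absurd (hM t ht0 htT i n) (not_le.2 hlt)

/-- **ROBUST BLOW-UP ⇒ EVERY RENORMALISED VISCOUS COMPANION IS `EternalSurvivingFwd 1`** — the survival predicate of the
registered stub at the registered exponent `a = 1`, for the renormalisation `W_n(σ) = Λ^n e^{-σ} x_n(T - e^{-σ})` of the
maximal `ν̂`-viscous flow of a robustly blowing-up table, for every `0 < ν̂ ≤ κ/√2` (level `c = B₀(ν̂)²`; lateness automatic).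
[cite: Tao2016AveragedNS, §4 Thm. 4.2, the viscous equation before Thm. 4.2, §6.4; cell vocabulary (`EternalSurvivingFwd`)] -/
theorem eternalSurvivingFwd_one_viscous_of_noGlobalCascade {ε₀ R : ℝ} (hε : 0 < ε₀)
    {α : Fin m → Fin m → Fin m → ℤ × ℤ × ℤ → ℝ} {X₀ : Fin m → ℝ} (hα : InTableClass R α)
    (hNG : NoGlobalCascade ε₀ α X₀) :
    ∃ κ : ℝ, 0 < κ ∧ ∀ visc : ℝ, 0 < visc → visc * Real.sqrt 2 ≤ κ →
      ∃ (T : ℝ) (X : Fin m → ℤ → ℝ → ℝ), 0 < T ∧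
        (∀ i n, ContDiffOn ℝ 1 (X i n) (Set.Ico 0 T)) ∧
        (∀ i n, X i n 0 = if n = 0 then X₀ i else 0) ∧
        (∀ i n t, n < 0 → X i n t = 0) ∧
        (∀ i n t, 0 ≤ t → t < T → derivWithin (X i n) (Set.Ici 0) t =
          quadTerm ε₀ α X i n t - visc * (1 + ε₀) ^ ((2 : ℝ) * n) * X i n t) ∧
        (∀ M : ℝ, ∃ t : ℝ, 0 ≤ t ∧ t < T ∧
          ∃ (i : Fin m) (n : ℤ), M < (1 + (1 + ε₀) ^ ((10 : ℝ) * n)) * |X i n t|) ∧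
        ∀ W : ℤ → ℝ → Em m,
          (∀ n σ, W n σ = (bigLam ε₀ ^ n * Real.exp (-σ)) • shellVec X n (T - Real.exp (-σ))) →
          EternalSurvivingFwd 1 ε₀ W := by
  obtain ⟨κ, hκ, H⟩ := criticalFloor_of_noGlobalCascade hε hα hNG
  refine ⟨κ, hκ, fun visc hvisc hvk => ?_⟩
  obtain ⟨T, X, hT, h1, h2, h3, h4, h5, h6, hfl⟩ := H visc hvisc hvk
  refine ⟨T, X, hT, h1, h2, h3, h4, h6, fun W hW => ?_⟩
  have hreg : ∀ T' : ℝ, T' < T → ∃ M : ℝ, ∀ τ ∈ Icc (0 : ℝ) T', ∀ (i : Fin m) (k : ℤ),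
      (1 + (1 + ε₀) ^ ((10 : ℝ) * k)) * |X i k τ| ≤ M := by
    intro T' hT'
    rcases le_or_gt T' 0 with h0 | h0
    · obtain ⟨M, hM⟩ := h5 (T / 2) (by linarith) (by linarith)
      exact ⟨M, fun τ hτ i k => hM τ hτ.1 (by linarith [hτ.2]) i k⟩
    · obtain ⟨M, hM⟩ := h5 T' h0 hT'
      exact ⟨M, fun τ hτ i k => hM τ hτ.1 hτ.2 i k⟩
  have hC0 : 0 ≤ shiftConst α (0, 0, 1) := shiftConst_nonneg α _
  have hB₀ : 0 < visc / (2 * (shiftConst α (0, 0, 1) + 1) * (1 + ε₀) ^ 9) := by positivity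
  refine eternalSurvivingFwd_one_of_peaks hε hreg hW (pow_pos hB₀ 2) fun N => ?_
  obtain ⟨j, t, hj, ht0, htT, hlt⟩ := hfl N
  exact ⟨j, hj, t, ht0, htT, hlt.le⟩

end BlowupRigidityOne

end Summit.NavierStokesRegularity.NavierStokesRegularity.Theorems

end
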